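import Mathlib
import HarnessLib
import Summits.Ventures.LatticeQCDFlow.Scoring.SplitChain
import Summits.Ventures.LatticeQCDFlow.Exactness.IMHKernel

/-!
# Retrospective regeneration coins for independence Metropolis, WEIGHT FORM: with `π = w · q` and a
# regeneration rate `e` with `e · w ≤ 1`, the coin "heads with probability `e · max(w x, w y)` after an
# accepted move" realises the split kernel of `(indepMH q w, π, e)` exactly

HONEST FRAMING: exact (Metropolis-corrected) sampling algorithms for lattice gauge theory;
figures of merit are autocorrelation/cost numbers at stated couplings and volumes; no
continuum-physics claim.

Venture `LatticeQCDFlow` (cell pub-lqcd), topic `Scoring`; FANOUT row 8 (`s0-cpn-nemc`, GEN-17).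
NEW WORK of the cell, not a published result; no definition is introduced.  Companion of
`Scoring/IndepMHRetrospectiveCoins.lean` (which is parametrised by a density-RATIO bound
`ρ x ≤ e^{M} ρ y`, rate `e^{−M}`) in the parametrisation of the exact flow sampler
(`Exactness.flowSampler_exact_doeblin`: a weight `w = dπ/dq` with `w ≤ e^{2δ}`, rate `e^{−2δ}`), which is
sharper whenever an absolute bound on `w` is known: for ANY rate `e ∈ (0, 1)` with `e · w ≤ 1`
pointwise and ANY proof that `K(x, ·) ≥ e π` (`K = indepMH q w`), the coin-augmented Metropolis step —
propose `y ∼ q`, accept with probability `min(1, w y/w x)`, on acceptance heads with probability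
`e · max(w x, w y)`, on rejection tails — has the law `(e π) ⊗ δ_heads + ((1 − e) R(x, ·)) ⊗ δ_tails`,
the split kernel of `Scoring/SplitChain.lean`; and a Markov kernel on `Ω × Bool` with these one-step
laws exists.  Identities: `min(1, w y/w x) · max(w x, w y) = w y`, so `∫_B a r dq = e π(B)`; and
`∫_B a(1 − r) dq + (1 − A(x)) 1_B(x) = K(x, B) − e π(B) = (1 − e) R(x, B)`.  Printed counterpart NAMED
ONLY: Mykland–Tierney–Yu 1995 §4.1, eq. (11) — nothing is cited as a fact.

## Content (`q` probability law, `w > 0` measurable, `π = w · q` a probability law, `0 < e < 1`,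
## `e · w ≤ 1`; `a = imhAcceptE w`, `A = imhAcceptMass q w`, `r(x, y) = e · max(w x, w y)`)

* `retroCoinSup_mem` — `0 ≤ r ≤ 1`; **`indepMH_retroSup_heads`** — `∫⁻_B a r dq = e π(B)`;
* **`indepMH_retroSup_tails`** — `∫⁻_B a (1 − r) dq + (1 − A x) 1_B(x) = (1 − e) R(x, B)`;
* **`indepMH_retroSup_eq_split`**, **`exists_indepMH_retroSupKernel`** — the coin-augmented step IS
  the split kernel; an implementable split kernel exists.

NOT CLAIMED: any `e`, `w` of a concrete sampler; a sampling algorithm for `q`.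
-/

noncomputable section

namespace Summit.Ventures.LatticeQCDFlow.Scoring

open MeasureTheory ProbabilityTheory Filter Summit.Ventures.LatticeQCDFlow.Exactness
open Literature.Probability.MarkovChains
open scoped ENNReal

variable {Ω : Type*} [MeasurableSpace Ω]

section RetroSup

variable {q : Measure Ω} [IsProbabilityMeasure q] {w : Ω → ℝ} {π : Measure Ω} [IsProbabilityMeasure π]
  {e : ℝ}

omit [MeasurableSpace Ω] [IsProbabilityMeasure q] [IsProbabilityMeasure π] in
/-- The coin probability `r(x, y) = e · max(w x, w y)` lies in `[0, 1]`. -/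
theorem retroCoinSup_mem (hw0 : ∀ x, 0 < w x) (he0 : 0 < e) (hew : ∀ x, e * w x ≤ 1) (x y : Ω) :
    0 ≤ e * max (w x) (w y) ∧ e * max (w x) (w y) ≤ 1 := by
  refine ⟨mul_nonneg he0.le ((hw0 x).le.trans (le_max_left _ _)), ?_⟩
  rcases le_total (w x) (w y) with h | h
  · rw [max_eq_right h]; exact hew y
  · rw [max_eq_left h]; exact hew x

omit [IsProbabilityMeasure q] [IsProbabilityMeasure π] in
/-- The coin density is measurable in `y`. -/
theorem measurable_retroCoinSup (hw : Measurable w) (x : Ω) :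
    Measurable fun y => ENNReal.ofReal (e * max (w x) (w y)) :=
  (measurable_const.mul (measurable_const.max hw)).ennreal_ofReal

omit [IsProbabilityMeasure q] [IsProbabilityMeasure π] in
/-- **Heads part**: `∫⁻_{B} a(x,y) · r(x,y) q(dy) = e · π(B)` — pointwise
`min(1, w y / w x) · e max(w x, w y) = e · w y`. -/
theorem indepMH_retroSup_heads (hw : Measurable w) (hw0 : ∀ x, 0 < w x)
    (hπ : (q.withDensity fun x => ENNReal.ofReal (w x)) = π) (he0 : 0 < e) (x : Ω) {B : Set Ω}
    (hB : MeasurableSet B) :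
    ∫⁻ y in B, imhAcceptE w x y * ENNReal.ofReal (e * max (w x) (w y)) ∂q
      = ENNReal.ofReal e * π B := by
  rw [← hπ, withDensity_apply _ hB, ← lintegral_const_mul _ hw.ennreal_ofReal]
  refine lintegral_congr fun y => ?_
  simp only [imhAcceptE, imhAccept]
  have h1 : 0 ≤ min 1 (w y / w x) := le_min zero_le_one (div_nonneg (hw0 y).le (hw0 x).le)
  rw [← ENNReal.ofReal_mul h1, ← ENNReal.ofReal_mul he0.le]
  congr 1
  have hx := hw0 x
  have hy := hw0 y
  rcases le_or_gt (w y) (w x) with hxy | hxy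
  · rw [min_eq_right ((div_le_one hx).2 hxy), max_eq_left hxy]
    field_simp
  · rw [min_eq_left ((one_le_div hx).2 hxy.le), max_eq_right hxy.le]
    ring

/-- **Tails part**: `∫⁻_{B} a(x,y)(1 − r(x,y)) q(dy) + (1 − A(x)) 1_B(x) = (1 − e) R(x, B)`, `R` the
residual kernel of ANY minorisation proof `K(x, ·) ≥ e π`. -/
theorem indepMH_retroSup_tails (hw : Measurable w) (hw0 : ∀ x, 0 < w x)
    (hπ : (q.withDensity fun x => ENNReal.ofReal (w x)) = π) (he0 : 0 < e) (he1 : e < 1)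
    (hew : ∀ x, e * w x ≤ 1)
    (hmin : haveI : Fact (Measurable w) := ⟨hw⟩
      ∀ x {B : Set Ω}, MeasurableSet B → ENNReal.ofReal e * π B ≤ indepMH q w x B)
    (x : Ω) {B : Set Ω} (hB : MeasurableSet B) :
    haveI : Fact (Measurable w) := ⟨hw⟩
    ∫⁻ y in B, imhAcceptE w x y * (1 - ENNReal.ofReal (e * max (w x) (w y))) ∂q
      + (1 - imhAcceptMass q w x) * B.indicator 1 x
      = (1 - ENNReal.ofReal e) * Doeblin.residualKernel (indepMH q w) π (ENNReal.ofReal e) hmin x B := by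
  haveI : Fact (Measurable w) := ⟨hw⟩
  have hε1 : ENNReal.ofReal e < 1 := by rw [ENNReal.ofReal_lt_one]; exact he1
  have ham : Measurable fun y => imhAcceptE w x y := (measurable_imhAcceptE hw).of_uncurry_left
  have hrm := measurable_retroCoinSup (e := e) hw x
  have hr1 : ∀ y, ENNReal.ofReal (e * max (w x) (w y)) ≤ 1 := fun y => by
    rw [← ENNReal.ofReal_one]
    exact ENNReal.ofReal_le_ofReal (retroCoinSup_mem hw0 he0 hew x y).2
  have hheads := indepMH_retroSup_heads hw hw0 hπ he0 x hB
  have hle : ∀ y, imhAcceptE w x y * ENNReal.ofReal (e * max (w x) (w y)) ≤ imhAcceptE w x y :=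
    fun y => by
      calc _ ≤ imhAcceptE w x y * 1 := mul_le_mul' le_rfl (hr1 y)
        _ = _ := mul_one _
  have hmeas : Measurable fun y => imhAcceptE w x y * ENNReal.ofReal (e * max (w x) (w y)) :=
    ham.mul hrm
  have hfin : ∫⁻ y in B, imhAcceptE w x y * ENNReal.ofReal (e * max (w x) (w y)) ∂q ≠ ∞ := by
    rw [hheads]
    exact ENNReal.mul_ne_top ENNReal.ofReal_ne_top (measure_ne_top π B)
  have hsub : ∫⁻ y in B, imhAcceptE w x y * (1 - ENNReal.ofReal (e * max (w x) (w y))) ∂q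
      = (∫⁻ y in B, imhAcceptE w x y ∂q) - ENNReal.ofReal e * π B := by
    rw [← hheads, ← lintegral_sub hmeas hfin (ae_of_all _ hle)]
    refine lintegral_congr fun y => ?_
    rw [ENNReal.mul_sub (fun _ _ => ne_top_of_le_ne_top ENNReal.one_ne_top
      (imhAcceptE_le_one _ x y)), mul_one]
  have hdom : ENNReal.ofReal e * π B ≤ ∫⁻ y in B, imhAcceptE w x y ∂q := by
    rw [← hheads]
    exact lintegral_mono hle
  have hK := Doeblin.apply_eq_add_residual (κ := indepMH q w) (ν := π) (hmin := hmin) hε1 x hB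
  rw [indepMH_apply hw x hB] at hK
  have hεfin : ENNReal.ofReal e * π B ≠ ∞ :=
    ENNReal.mul_ne_top ENNReal.ofReal_ne_top (measure_ne_top π B)
  rw [hsub, ENNReal.sub_add_eq_add_sub hdom hεfin]
  refine (ENNReal.eq_sub_of_add_eq hεfin ?_).symm
  rw [hK, add_comm]

/-- **THE COIN-AUGMENTED METROPOLIS STEP IS THE SPLIT KERNEL (weight form).** -/
theorem indepMH_retroSup_eq_split (hw : Measurable w) (hw0 : ∀ x, 0 < w x)
    (hπ : (q.withDensity fun x => ENNReal.ofReal (w x)) = π) (he0 : 0 < e) (he1 : e < 1)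
    (hew : ∀ x, e * w x ≤ 1)
    (hmin : haveI : Fact (Measurable w) := ⟨hw⟩
      ∀ x {B : Set Ω}, MeasurableSet B → ENNReal.ofReal e * π B ≤ indepMH q w x B) (x : Ω) :
    haveI : Fact (Measurable w) := ⟨hw⟩
    (q.withDensity (fun y => imhAcceptE w x y * ENNReal.ofReal (e * max (w x) (w y)))).map
        (fun y : Ω => (y, true))
      + ((q.withDensity (fun y => imhAcceptE w x y * (1 - ENNReal.ofReal (e * max (w x) (w y)))))
        + (1 - imhAcceptMass q w x) • Measure.dirac x).map (fun y : Ω => (y, false))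
    = (ENNReal.ofReal e • π).map (fun y : Ω => (y, true))
      + ((1 - ENNReal.ofReal e) • Doeblin.residualKernel (indepMH q w) π (ENNReal.ofReal e) hmin x).map
        (fun y : Ω => (y, false)) := by
  haveI : Fact (Measurable w) := ⟨hw⟩
  have H1 : q.withDensity (fun y => imhAcceptE w x y * ENNReal.ofReal (e * max (w x) (w y)))
      = ENNReal.ofReal e • π := by
    ext B hB
    rw [withDensity_apply _ hB, Measure.smul_apply, smul_eq_mul]
    exact indepMH_retroSup_heads hw hw0 hπ he0 x hB
  have H2 : q.withDensity (fun y => imhAcceptE w x y * (1 - ENNReal.ofReal (e * max (w x) (w y))))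
      + (1 - imhAcceptMass q w x) • Measure.dirac x
      = (1 - ENNReal.ofReal e) • Doeblin.residualKernel (indepMH q w) π (ENNReal.ofReal e) hmin x := by
    ext B hB
    rw [Measure.add_apply, withDensity_apply _ hB, Measure.smul_apply, smul_eq_mul,
      Measure.dirac_apply' x hB, Measure.smul_apply, smul_eq_mul]
    exact indepMH_retroSup_tails hw hw0 hπ he0 he1 hew hmin x hB
  rw [H1, H2]

/-- **AN IMPLEMENTABLE SPLIT KERNEL EXISTS (weight form)**: a Markov kernel on `Ω × Bool` which at
every `(x, b)` is the coin-augmented Metropolis step from `x`, and which satisfies the split-kernel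
equation for `(indepMH q w, π, e)` with the given minorisation proof. -/
theorem exists_indepMH_retroSupKernel (hw : Measurable w) (hw0 : ∀ x, 0 < w x)
    (hπ : (q.withDensity fun x => ENNReal.ofReal (w x)) = π) (he0 : 0 < e) (he1 : e < 1)
    (hew : ∀ x, e * w x ≤ 1)
    (hmin : haveI : Fact (Measurable w) := ⟨hw⟩
      ∀ x {B : Set Ω}, MeasurableSet B → ENNReal.ofReal e * π B ≤ indepMH q w x B) :
    haveI : Fact (Measurable w) := ⟨hw⟩
    ∃ κs : Kernel (Ω × Bool) (Ω × Bool), IsMarkovKernel κs ∧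
      (∀ p, κs p = (q.withDensity (fun y => imhAcceptE w p.1 y
          * ENNReal.ofReal (e * max (w p.1) (w y)))).map (fun y : Ω => (y, true))
        + ((q.withDensity (fun y => imhAcceptE w p.1 y
            * (1 - ENNReal.ofReal (e * max (w p.1) (w y)))))
          + (1 - imhAcceptMass q w p.1) • Measure.dirac p.1).map (fun y : Ω => (y, false))) ∧
      (∀ p, κs p = (ENNReal.ofReal e • π).map (fun y : Ω => (y, true))
        + ((1 - ENNReal.ofReal e) • Doeblin.residualKernel (indepMH q w) π (ENNReal.ofReal e) hmin
            p.1).map (fun y : Ω => (y, false))) := by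
  haveI : Fact (Measurable w) := ⟨hw⟩
  have hε1 : ENNReal.ofReal e < 1 := by rw [ENNReal.ofReal_lt_one]; exact he1
  obtain ⟨κs, hκsM, hκs⟩ := exists_splitKernel (κ := indepMH q w) (ν := π) (hmin := hmin) hε1
  refine ⟨κs, hκsM, fun p => ?_, hκs⟩
  rw [hκs p, indepMH_retroSup_eq_split hw hw0 hπ he0 he1 hew hmin p.1]

end RetroSup

end Summit.Ventures.LatticeQCDFlow.Scoring

end
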